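import Mathlib
import Summits.MatrixMultiplication.MatrixMultiplication.Theorems.SnSubsetDichotomyPolynomialSlackKeptSplitC
import Summits.MatrixMultiplication.MatrixMultiplication.Theorems.SnSubsetDichotomyPolynomialSlackDensePair

/-!
# Beyond one half, two dense quotients: the volume bound

Crux `Summit.MatrixMultiplication.MatrixMultiplication.Theses.SnSubsetDichotomy.PolynomialSlack`
(item `stmt-MatrixMultiplication-8306`), level-one programme, lead c6 ("beyond one half"). For a parity-pure
TPP triple `S, T, U ⊆ S_n` (`n ≥ 40`) whose quotient `C = U⁻¹S` is NON-DENSE at scale `M`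
(`K_C = n!/(|U||S|) ≥ 16M`; the two other quotients are kept whole, so this is the case to use when they are
dense), the kept level-one inequality (`kept_split_C`) forces a heavy cell of the `C`-profile and one-point
fibring through it (`volume_le_of_dense_pair`) gives `θ_C²·|S||T||U| ≤ n·B`, `θ_C = K_C/(nM)`, for every
bound `B` on the volumes of TPP triples of `S_{n-1}`, as soon as the explicit level-one error
`δ = n!/(2N) + n!√(n!)/(2N√(n(n-1)/6)) + 3√(100(1+log n)L/M)·F/√(n-1)` is `< 1` (`volume_le_of_split_C`).
-/

namespace Summit.MatrixMultiplication.MatrixMultiplication.Theorems.PolynomialSlack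

open scoped BigOperators
open Literature.Combinatorics.Additive (TripleProductProperty)

-- `Summit.<Summit>.<Problem>` is the tree's mandated summit-side namespace (CONVENTIONS §2); for
-- this single-conjunct summit the two coincide, so each declaration silences `dupNamespace`.
set_option linter.dupNamespace false

/-- **Two dense quotients: the volume bound.** For `n ≥ 40`, a parity-pure TPP triple of non-empty sets
with `K_C = n!/(|U||S|) ≥ 16M`, `log(4n·n!/|U||S|) ≤ L` and level-one error `δ < 1`:
`θ_C²·|S||T||U| ≤ n·B` with `θ_C = n!/(|U||S|·n·M)`, for every bound `B` on TPP volumes of `S_{n-1}`.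
[folklore] -/
theorem volume_le_of_split_C {n : ℕ} (hn : 40 ≤ n) (B : ℕ)
    (hB : ∀ S' T' U' : Finset (Equiv.Perm (Fin (n - 1))), TripleProductProperty S' T' U' →
      S'.card * T'.card * U'.card ≤ B)
    {S T U : Finset (Equiv.Perm (Fin n))} (hTPP : TripleProductProperty S T U)
    (hS0 : S.Nonempty) (hT0 : T.Nonempty) (hU0 : U.Nonempty)
    (hS : ∀ s ∈ S, ∀ s' ∈ S, Equiv.Perm.sign s = Equiv.Perm.sign s')
    (hT : ∀ t ∈ T, ∀ t' ∈ T, Equiv.Perm.sign t = Equiv.Perm.sign t')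
    (hU : ∀ u ∈ U, ∀ u' ∈ U, Equiv.Perm.sign u = Equiv.Perm.sign u')
    (M L : ℝ) (hM : 1 ≤ M) (hL : 1 ≤ L)
    (hKC : 16 * M ≤ (n.factorial : ℝ) / (U.card * S.card : ℕ))
    (hLC : Real.log (4 * n * n.factorial / (U.card * S.card : ℕ)) ≤ L)
    (hsmall : (n.factorial : ℝ) / (2 * (S.card * T.card * U.card : ℕ)) +
          (n.factorial : ℝ) * Real.sqrt (n.factorial : ℝ) /
            (2 * (S.card * T.card * U.card : ℕ) * Real.sqrt (((n * (n - 1) : ℕ) : ℝ) / 6)) +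
          3 * Real.sqrt (100 * (1 + Real.log n) * L / M) *
            ((n.factorial : ℝ) * Real.sqrt (n.factorial : ℝ) / (S.card * T.card * U.card : ℕ)) /
              Real.sqrt ((n : ℝ) - 1) < 1) :
    ((n.factorial : ℝ) / ((U.card * S.card : ℕ) * n * M)) ^ 2 * ((S.card * T.card * U.card : ℕ) : ℝ) ≤
      n * B := by
  classical
  have hn2 : 2 ≤ n := by omega
  have hnR : (40 : ℝ) ≤ n := by exact_mod_cast hn
  have hn0 : (0 : ℝ) < n := by linarith
  have hM0 : 0 < M := by linarith
  have hγ0 : (0 : ℝ) < (U.card * S.card : ℕ) := by exact_mod_cast Nat.mul_pos hU0.card_pos hS0.card_pos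
  set θC : ℝ := (n.factorial : ℝ) / ((U.card * S.card : ℕ) * n * M) with hθC
  have hθC16 : 16 / (n : ℝ) ≤ θC := by
    rw [hθC, div_le_div_iff₀ hn0 (by positivity)]
    rw [le_div_iff₀ hγ0] at hKC
    nlinarith
  set dA : Fin n → Fin n → ℝ := fun i j =>
    (((S ×ˢ T).filter fun st => st.2 j = st.1 i).card : ℝ) / (S.card * T.card : ℕ) with hdA
  set dB : Fin n → Fin n → ℝ := fun j k =>
    (((T ×ˢ U).filter fun tu => tu.2 k = tu.1 j).card : ℝ) / (T.card * U.card : ℕ) with hdB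
  set dC : Fin n → Fin n → ℝ := fun k i =>
    (((U ×ˢ S).filter fun us => us.2 i = us.1 k).card : ℝ) / (U.card * S.card : ℕ) with hdC
  set pC : Fin n → Fin n → ℝ := fun k i => if θC ≤ dC k i then dC k i - 1 / n else 0 with hpC
  have hkept := kept_split_C hn hTPP hS0 hT0 hU0 hS hT hU dA dB dC pC (fun _ _ => rfl)
    (fun _ _ => rfl) (fun _ _ => rfl) M L hM hL hKC hLC (fun _ _ => rfl)
  exact volume_le_of_dense_pair hn2 B hB hTPP hS0 hT0 hU0 dA dB dC pC (fun _ _ => rfl) (fun _ _ => rfl)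
    (fun _ _ => rfl) θC _ hθC16 (fun _ _ => rfl) hsmall hkept

set_option maxHeartbeats 1600000 in
/-- **Two dense quotients, explicit form.** In the labelling where `A = S⁻¹T` and `B = T⁻¹U` are dense
(`K_A, K_B < 16M`) and `C = U⁻¹S` is not (`K_C ≥ 16M`), a parity-pure TPP triple with `F = n!√(n!)/N ≤ 8n^{C₁}`,
`F² ≥ (n-1)/4`, `log(4n·n!/|U||S|) ≤ log(256n³)` and small explicit level-one error satisfies
`|S||T||U| ≤ n·(1024·n·M³)²/(n-1)² · B` for every bound `B` on the TPP volumes of `S_{n-1}`. [folklore] -/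
theorem volume_le_of_two_dense {n : ℕ} (hn : 40 ≤ n) (B : ℕ)
    (hB : ∀ S' T' U' : Finset (Equiv.Perm (Fin (n - 1))), TripleProductProperty S' T' U' →
      S'.card * T'.card * U'.card ≤ B)
    {S T U : Finset (Equiv.Perm (Fin n))} (hTPP : TripleProductProperty S T U)
    (hS0 : S.Nonempty) (hT0 : T.Nonempty) (hU0 : U.Nonempty)
    (hS : ∀ s ∈ S, ∀ s' ∈ S, Equiv.Perm.sign s = Equiv.Perm.sign s')
    (hT : ∀ t ∈ T, ∀ t' ∈ T, Equiv.Perm.sign t = Equiv.Perm.sign t')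
    (hU : ∀ u ∈ U, ∀ u' ∈ U, Equiv.Perm.sign u = Equiv.Perm.sign u')
    (C₁ M : ℝ) (hM : 1 ≤ M)
    (hKA : (n.factorial : ℝ) / (S.card * T.card : ℕ) < 16 * M)
    (hKB : (n.factorial : ℝ) / (T.card * U.card : ℕ) < 16 * M)
    (hKC : 16 * M ≤ (n.factorial : ℝ) / (U.card * S.card : ℕ))
    (hF : (n.factorial : ℝ) * Real.sqrt (n.factorial : ℝ) / (S.card * T.card * U.card : ℕ) ≤
      8 * (n : ℝ) ^ C₁)
    (hF2 : ((n : ℝ) - 1) / 4 ≤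
      ((n.factorial : ℝ) * Real.sqrt (n.factorial : ℝ) / (S.card * T.card * U.card : ℕ)) ^ 2)
    (hLC : Real.log (4 * n * n.factorial / (U.card * S.card : ℕ)) ≤ Real.log (256 * (n : ℝ) ^ 3))
    (hsmall : 8 * (n : ℝ) ^ C₁ * (Real.sqrt 6 / Real.sqrt ((n : ℝ) * ((n : ℝ) - 1)) +
        30 * Real.sqrt ((1 + Real.log n) * Real.log (256 * (n : ℝ) ^ 3) / M) / Real.sqrt ((n : ℝ) - 1)) < 1) :
    ((S.card * T.card * U.card : ℕ) : ℝ) ≤ (n : ℝ) * (1024 * (n : ℝ) * M ^ 3) ^ 2 / ((n : ℝ) - 1) ^ 2 * B := by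
  classical
  have hn1 : 1 ≤ n := by omega
  have hnR : (40 : ℝ) ≤ n := by exact_mod_cast hn
  have hn0 : (0 : ℝ) < n := by linarith
  have hm0 : (0 : ℝ) < (n : ℝ) - 1 := by linarith
  have hM0 : 0 < M := by linarith
  have hf0 : (0 : ℝ) < n.factorial := by exact_mod_cast n.factorial_pos
  set cS : ℝ := (S.card : ℝ) with hcS
  set cT : ℝ := (T.card : ℝ) with hcT
  set cU : ℝ := (U.card : ℝ) with hcU
  have hcS0 : 0 < cS := by rw [hcS]; exact_mod_cast hS0.card_pos
  have hcT0 : 0 < cT := by rw [hcT]; exact_mod_cast hT0.card_pos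
  have hcU0 : 0 < cU := by rw [hcU]; exact_mod_cast hU0.card_pos
  have hαe : ((S.card * T.card : ℕ) : ℝ) = cS * cT := by push_cast; rw [hcS, hcT]
  have hβe : ((T.card * U.card : ℕ) : ℝ) = cT * cU := by push_cast; rw [hcT, hcU]
  have hγe : ((U.card * S.card : ℕ) : ℝ) = cU * cS := by push_cast; rw [hcU, hcS]
  have hNe : ((S.card * T.card * U.card : ℕ) : ℝ) = cS * cT * cU := by push_cast; rw [hcS, hcT, hcU]
  clear_value cS cT cU
  rw [hαe] at hKA; rw [hβe] at hKB; rw [hγe] at hKC hLC; rw [hNe] at hF hF2 ⊢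
  set f : ℝ := (n.factorial : ℝ) with hf
  set G : ℝ := 1 + Real.log n with hG
  set L : ℝ := Real.log (256 * (n : ℝ) ^ 3) with hL
  have hL1 : 1 ≤ L := by
    rw [hL, ← Real.log_exp 1]
    apply Real.log_le_log (Real.exp_pos 1)
    have h3 : (1 : ℝ) ≤ (n : ℝ) ^ 3 := one_le_pow₀ (by linarith)
    linarith [Real.exp_one_lt_d9]
  set KA : ℝ := f / (cS * cT) with hKAdef
  set KB : ℝ := f / (cT * cU) with hKBdef
  set KC : ℝ := f / (cU * cS) with hKCdef
  have hKA0 : 0 < KA := by rw [hKAdef]; positivity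
  have hKB0 : 0 < KB := by rw [hKBdef]; positivity
  have hKC0 : 0 < KC := by rw [hKCdef]; positivity
  set F : ℝ := f * Real.sqrt f / (cS * cT * cU) with hFdef
  have hKKK : KA * KB * KC = F ^ 2 := by
    rw [hKAdef, hKBdef, hKCdef, hFdef, div_pow, mul_pow, Real.sq_sqrt hf0.le]
    field_simp
  -- `K_C > (n-1)/(1024 M²)`
  have hKClow : ((n : ℝ) - 1) / (1024 * M ^ 2) ≤ KC := by
    have h1 : KA * KB * KC = F ^ 2 := hKKK
    have h2 : KA * KB < 16 * M * (16 * M) := mul_lt_mul'' hKA hKB hKA0.le hKB0.le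
    rw [div_le_iff₀ (by positivity)]
    have h3 : F ^ 2 ≤ 16 * M * (16 * M) * KC := by
      rw [← h1]; exact mul_le_mul_of_nonneg_right h2.le hKC0.le
    nlinarith
  set θC : ℝ := f / (cU * cS * n * M) with hθC
  have hθCe : θC = KC / (n * M) := by rw [hθC, hKCdef]; field_simp
  have hθClow : ((n : ℝ) - 1) / (1024 * (n : ℝ) * M ^ 3) ≤ θC := by
    rw [hθCe, div_le_div_iff₀ (by positivity) (by positivity)]
    rw [div_le_iff₀ (by positivity)] at hKClow
    calc ((n : ℝ) - 1) * (n * M) ≤ KC * (1024 * M ^ 2) * (n * M) :=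
          mul_le_mul_of_nonneg_right hKClow (by positivity)
      _ = KC * (1024 * (n : ℝ) * M ^ 3) := by ring
  have hθC0 : 0 < θC := lt_of_lt_of_le (by positivity) hθClow
  /- the level-one error `δ ≤ δmax < 1` -/
  have hD : Real.sqrt (((n * (n - 1) : ℕ) : ℝ) / 6) = Real.sqrt ((n : ℝ) * ((n : ℝ) - 1)) / Real.sqrt 6 := by
    have : (((n * (n - 1) : ℕ) : ℝ)) = (n : ℝ) * ((n : ℝ) - 1) := by
      push_cast [Nat.cast_sub hn1]; ring
    rw [this, Real.sqrt_div' _ (by norm_num : (0 : ℝ) ≤ 6)]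
  have hnn0 : 0 < (n : ℝ) * ((n : ℝ) - 1) := by positivity
  have hsnn : 0 < Real.sqrt ((n : ℝ) * ((n : ℝ) - 1)) := Real.sqrt_pos.2 hnn0
  have hs6 : 0 < Real.sqrt 6 := Real.sqrt_pos.2 (by norm_num)
  have hsf : Real.sqrt ((n : ℝ) * ((n : ℝ) - 1)) / Real.sqrt 6 ≤ Real.sqrt f := by
    rw [div_le_iff₀ hs6, ← Real.sqrt_mul hf0.le]
    apply Real.sqrt_le_sqrt
    have hnf : (n : ℝ) * ((n : ℝ) - 1) ≤ f := by
      rw [hf]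
      have hh : n * (n - 1) ≤ n.factorial := by
        rw [← Nat.mul_factorial_pred (show n ≠ 0 by omega)]
        exact Nat.mul_le_mul_left n (Nat.self_le_factorial _)
      have e : ((n * (n - 1) : ℕ) : ℝ) = (n : ℝ) * ((n : ℝ) - 1) := by
        push_cast [Nat.cast_sub hn1]; ring
      rw [← e]; exact_mod_cast hh
    nlinarith
  have hN0 : 0 < cS * cT * cU := by positivity
  have hF0 : 0 < F := by rw [hFdef]; positivity
  have hδ12 : f / (2 * (cS * cT * cU)) + f * Real.sqrt f / (2 * (cS * cT * cU) *
      Real.sqrt (((n * (n - 1) : ℕ) : ℝ) / 6)) ≤ F * (Real.sqrt 6 / Real.sqrt ((n : ℝ) * ((n : ℝ) - 1))) := by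
    rw [hD, hFdef]
    set q : ℝ := Real.sqrt 6 / Real.sqrt ((n : ℝ) * ((n : ℝ) - 1)) with hq
    have hq0 : 0 < q := by rw [hq]; positivity
    have hq1 : 1 ≤ Real.sqrt f * q := by
      rw [hq, mul_div_assoc', le_div_iff₀ hsnn, one_mul]
      calc Real.sqrt ((n : ℝ) * ((n : ℝ) - 1))
          = Real.sqrt ((n : ℝ) * ((n : ℝ) - 1)) / Real.sqrt 6 * Real.sqrt 6 := by field_simp
        _ ≤ Real.sqrt f * Real.sqrt 6 := mul_le_mul_of_nonneg_right hsf hs6.le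
    have e1 : f * Real.sqrt f / (2 * (cS * cT * cU) * (Real.sqrt ((n : ℝ) * ((n : ℝ) - 1)) / Real.sqrt 6)) =
        f * Real.sqrt f / (cS * cT * cU) * q / 2 := by
      rw [hq]; field_simp
    have e2 : f / (2 * (cS * cT * cU)) ≤ f * Real.sqrt f / (cS * cT * cU) * q / 2 := by
      rw [div_le_iff₀ (by positivity)]
      have h1 : f ≤ f * (Real.sqrt f * q) := by nlinarith
      calc f ≤ f * (Real.sqrt f * q) := h1
        _ = f * Real.sqrt f / (cS * cT * cU) * q / 2 * (2 * (cS * cT * cU)) := by field_simp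
    rw [e1]; linarith
  have hδ3 : 3 * Real.sqrt (100 * G * L / M) * (f * Real.sqrt f / (cS * cT * cU)) / Real.sqrt ((n : ℝ) - 1) =
      F * (30 * Real.sqrt (G * L / M) / Real.sqrt ((n : ℝ) - 1)) := by
    have : Real.sqrt (100 * G * L / M) = 10 * Real.sqrt (G * L / M) := by
      rw [show 100 * G * L / M = 10 ^ 2 * (G * L / M) by ring, Real.sqrt_mul (by norm_num),
        Real.sqrt_sq (by norm_num)]
    rw [this, hFdef]; ring
  have hδlt : f / (2 * (cS * cT * cU)) + f * Real.sqrt f / (2 * (cS * cT * cU) *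
      Real.sqrt (((n * (n - 1) : ℕ) : ℝ) / 6)) +
      3 * Real.sqrt (100 * G * L / M) * (f * Real.sqrt f / (cS * cT * cU)) / Real.sqrt ((n : ℝ) - 1) < 1 := by
    rw [hδ3]
    have h1 : 0 ≤ Real.sqrt 6 / Real.sqrt ((n : ℝ) * ((n : ℝ) - 1)) := by positivity
    have h2 : 0 ≤ 30 * Real.sqrt (G * L / M) / Real.sqrt ((n : ℝ) - 1) := by positivity
    have hF' : F ≤ 8 * (n : ℝ) ^ C₁ := hF
    nlinarith [mul_le_mul_of_nonneg_right hF' h1, mul_le_mul_of_nonneg_right hF' h2]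
  /- apply the split bound -/
  have hmain := volume_le_of_split_C hn B hB hTPP hS0 hT0 hU0 hS hT hU M L hM hL1
    (by rw [hγe]; exact hKC) (by rw [hγe]; exact hLC) (by rw [hNe]; exact hδlt)
  rw [hNe, hγe] at hmain
  rw [show f / (cU * cS * ↑n * M) = θC from rfl] at hmain
  -- `θC² N ≤ n B` and `θC ≥ (n-1)/(1024 n M³)`
  have hB0 : (0 : ℝ) ≤ B := Nat.cast_nonneg _
  have hθlow0 : 0 < ((n : ℝ) - 1) / (1024 * (n : ℝ) * M ^ 3) := by positivity
  have hlow : (((n : ℝ) - 1) / (1024 * (n : ℝ) * M ^ 3)) ^ 2 ≤ θC ^ 2 := pow_le_pow_left₀ hθlow0.le hθClow 2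
  have e : (n : ℝ) * (1024 * (n : ℝ) * M ^ 3) ^ 2 / ((n : ℝ) - 1) ^ 2 * B =
      (n : ℝ) * B / (((n : ℝ) - 1) / (1024 * (n : ℝ) * M ^ 3)) ^ 2 := by
    field_simp
  rw [e, le_div_iff₀ (by positivity)]
  calc cS * cT * cU * (((n : ℝ) - 1) / (1024 * (n : ℝ) * M ^ 3)) ^ 2
      ≤ cS * cT * cU * θC ^ 2 := mul_le_mul_of_nonneg_left hlow hN0.le
    _ = θC ^ 2 * (cS * cT * cU) := by ring
    _ ≤ n * B := hmain

end Summit.MatrixMultiplication.MatrixMultiplication.Theorems.PolynomialSlack
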